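import Summits.HodgeConjecture.CorCM.PairFlipSexticFrame
import HarnessLib

/-!
# COR-CM — THE FOUR CM THREEFOLDS OF A SEXTIC CM FIELD WITH GALOIS CLOSURE OF DEGREE 24 OR 48 (the stage-1 field
# class): the Hodge conjecture for every product of powers `X₀^a × X₁^b × X₂^c × X₃^d` is EQUIVALENT to the Hodge
# conjecture in codimension 2 for the one 12-fold `X₀ × X₁ × X₂ × X₃` (intrinsic form)

Cell `pub-hodgecm2` (COR-CM), binder seat b25 (gen 37); COUNT-NEUTRAL own lane (work item W-b of the lead's B01-SIZE §4
T2, «what the stage-1 period statement would certify»); theorems only, no definition, no named fact, no `sorry`.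
Assembly of `Census/PairFlipSexticFourCore{,Powers}.lean` (the 24-point model: the Hodge lattice of ALL power products
is `ℤ⟨12 conjugate pairs, 3 faces⟩`), `CorCM/PairFlipSexticFourCoreTransfer.lean` + `…CodimTwo.lean` (frame form:
HC²(`X₀ × X₁ × X₂ × X₃`) ⟹ HC of every product of powers) and `CorCM/PairFlipSexticFrame.lean` (the frame
hypotheses from `[L:ℚ] ∈ {24, 48}`: pair flips, p2, and rotations).

SETTING.  `K` a CM field with `[K:ℚ] = 6` whose normal closure `L` has degree `24` or `48` (equivalently — p2,
`CorCM/SexticCMFieldPairFlip.lean`, `CorCM/GenericCMFieldPairFlipCriteria.lean` — `Gal(L/ℚ) ∈ {(ℤ/2)³ ⋊ C₃, ℤ/2 ≀ S₃}`;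
this is the field class of the stage-1 statement `PerL`); a half-system `t : ℤ/3 → Hom(K, ℂ)` (three pairwise
non-conjugate embeddings — a CM type `Φ₀ = {t 0, t 1, t 2}` enumerated); and realisations `A₄ b ⊨ (K; Φ₄ b)` on `H¹`
(`IsCMTypeRealisation`) of the FOUR CM types of `K` up to conjugation, in the normal form read by the model type `phi`
through the frame `frameOf h6 t`: `Φ₄ 0 = {t 0, t 1, t 2}` and `Φ₄ b` (`b = 1, 2, 3`) = `Φ₄ 0` with `t (b-1)` replaced
by its conjugate (every simple abelian threefold with CM by `K` is isogenous to one of the four `X_b = A₄ b`, and the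
conjugate types give the same varieties — `IsCMTypeRealisation.comp_complexConj`).

* **`hodgeConjectureFor_biproduct_comp_of_faces_of_finrank_normalClosure`** (face form) — if the six face weight lines
  of `X₀ × X₁ × X₂ × X₃` (= the `K`-Weil-line classes of the tetra relation, the socket of p2's PERL-WEIL-LINE files) are
  algebraic, then `HodgeConjectureFor (⨁_j A₄ (κ j))` for every slot map `κ`; `…_of_avDominatedBy_…` likewise;
* **`hodgeConjectureFor_biproduct_comp_of_hodgeClasses_two_of_finrank_normalClosure`** — if every rational
  `(2,2)`-class of `X₀ × X₁ × X₂ × X₃` is algebraic, then `HodgeConjectureFor (⨁_j A₄ (κ j))` for EVERY slot map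
  `κ : Fin N → Fin 4` (every product of powers, all codimensions);
* **`hodgeConjectureFor_of_avDominatedBy_…`** — … and for every abelian variety dominated by such a power (everything
  isogenous to a product of powers of `X₀, …, X₃`, their abelian subvarieties and quotients);
* `hodgeConjectureFor_biproduct_iff_hodgeClasses_two_of_finrank_normalClosure` — for the 12-fold itself the reduction is
  an `Iff`.
WHAT THIS SAYS FOR THE PROGRAMME (B01-SIZE §4 T2 / W-b): for the PerL field class, «HC for all abelian varieties with
complex multiplication through `K`» is ONE codimension-2 statement on ONE 12-fold, whose only non-divisorial content
is the 6-dimensional face species (`B²(X₀ × X₁ × X₂ × X₃) = D² ⊕` faces; `Census/PairFlipSexticFourCore.lean`) — the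
rank-four face class that a period statement of PerL type, transported to this non-Galois field (work item W-a, the
surface criterion over tetra quadruples), would make algebraic.  HONEST FRAMING: a reduction, not a case of the Hodge
conjecture; `HC_CM`, `PerL`, `PerLFace` are neither used nor proved here.
[cite: Pohlmann1968, Thm 1] [cite: GaoUllmo2025, Thm 3.1] [cite: Milne2020HodgeClassesAV, 1.2 (a) and Thm. 1]
[cite: Dodson1984, §5.1] [cite: MumfordAV1970, §19]

## References
* [Pohlmann1968] H. Pohlmann, Ann. of Math. 88 (1968), Thm 1.  [GaoUllmo2025] Z. Gao, E. Ullmo, J. Inst. Math. Jussieu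
  25 (2025), Thm 3.1.  [Milne2020HodgeClassesAV] J. S. Milne, arXiv:2010.08857.  [Dodson1984] B. Dodson, Trans. AMS
  283 (1984), §5.1.  [MumfordAV1970] D. Mumford, Abelian Varieties, §19.
-/

noncomputable section

open CategoryTheory CategoryTheory.Limits NumberField

namespace Summit.HodgeConjecture.CorCM.PairFlipSexticFourCore

open Literature.AlgebraicGeometry Literature.AlgebraicGeometry.Motives Literature.AlgebraicGeometry.HodgeTheory
open Literature.AlgebraicGeometry.ComplexMultiplication (IsCMTypeRealisation)
open Literature.AlgebraicTopology.SingularHomology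
open Literature.AlgebraicGeometry.Pohlmann1968 (weightClassesAlg)
open Summit.HodgeConjecture.CorCM.Census.PairFlipSexticFourCore (Pt phi face)

variable {K : Type} [Field K] [NumberField K] [IsCMField K] (h6 : Module.finrank ℚ K = 6)
  (L : Type) [Field L] [NumberField L] [IsNormalClosure ℚ K L]
  (hL : Module.finrank ℚ L = 24 ∨ Module.finrank ℚ L = 48)
  (t : ZMod 3 → (K →+* ℂ)) (ht : Function.Injective t) (htc : ∀ p q, t p ≠ ComplexEmbedding.conjugate (t q))
  {N : ℕ} {A₄ : Fin 4 → AbelianVariety ℂ} {Φ₄ : Fin 4 → CMType K} {ι₄ : ∀ b : Fin 4, 𝓞 K →+* End (A₄ b)}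
  {θ₄ : ∀ b : Fin 4, K →+* Module.End ℂ (complexBetti (A₄ b).X 1)}

include hL in
/-- **MAIN THEOREM (intrinsic frame, face form).**  `K` a sextic CM field with normal closure of degree `24` or `48`,
`t` a half-system, `A₄ b ⊨ (K; Φ₄ b)` in normal form for `frameOf h6 t`.  **If the six face weight lines of
`Y = X₀ × X₁ × X₂ × X₃` (the weights mapping onto `face i sg` under the frame) are algebraic, then
`HodgeConjectureFor (⨁_j A₄ (κ j))` for every slot map `κ`** — the frame hypotheses `he_conj`, `he_gal` of
`hodgeConjectureFor_biproduct_comp_of_faces` are discharged by `frameOf_conj` and `realised_rotate_flipAt`.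
[cite: Pohlmann1968, Thm 1] [cite: GaoUllmo2025, Thm 3.1] [cite: Milne2020HodgeClassesAV, Thm. 1] [cite: Dodson1984, §5.1] -/
theorem hodgeConjectureFor_biproduct_comp_of_faces_of_finrank_normalClosure
    (hA : ∀ b, IsCMTypeRealisation (Φ₄ b) (A₄ b) (ι₄ b) (θ₄ b))
    (hΦ : ∀ (b : Fin 4) (s : K →+* ℂ),
      s ∈ (Φ₄ b).1 ↔ ((b, (frameOf h6 t ht htc s).1, (frameOf h6 t ht htc s).2) : Pt) ∈ phi)
    (hface : ∀ (i : ZMod 3) (sg : Bool) (T : Finset ((_ : Fin 4) × (K →+* ℂ))),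
      T.image (toPt (frameOf h6 t ht htc)) = face i sg →
      weightClassesAlg (K := fun _ : Fin 4 => K) A₄ ι₄ (2 * 2) T ≤ algebraicClasses (⨁ A₄).X 2)
    (κ : Fin N → Fin 4) :
    HodgeConjectureFor (⨁ fun j => A₄ (κ j)).dim (⨁ fun j => A₄ (κ j)).X :=
  hodgeConjectureFor_biproduct_comp_of_faces κ hA (frameOf_conj h6 t ht htc) (realised_rotate_flipAt h6 L hL t ht htc)
    hΦ hface

include hL in
/-- **… and for every abelian variety dominated by such a power** (face form). [cite: Milne2020HodgeClassesAV, Thm. 1]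
[cite: MumfordAV1970, §19] -/
theorem hodgeConjectureFor_of_avDominatedBy_comp_of_faces_of_finrank_normalClosure
    (hA : ∀ b, IsCMTypeRealisation (Φ₄ b) (A₄ b) (ι₄ b) (θ₄ b))
    (hΦ : ∀ (b : Fin 4) (s : K →+* ℂ),
      s ∈ (Φ₄ b).1 ↔ ((b, (frameOf h6 t ht htc s).1, (frameOf h6 t ht htc s).2) : Pt) ∈ phi)
    (hface : ∀ (i : ZMod 3) (sg : Bool) (T : Finset ((_ : Fin 4) × (K →+* ℂ))),
      T.image (toPt (frameOf h6 t ht htc)) = face i sg →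
      weightClassesAlg (K := fun _ : Fin 4 => K) A₄ ι₄ (2 * 2) T ≤ algebraicClasses (⨁ A₄).X 2)
    (κ : Fin N → Fin 4) {B : AbelianVariety ℂ} (hB : Domination.AVDominatedBy B (⨁ fun j => A₄ (κ j))) :
    HodgeConjectureFor B.dim B.X :=
  Domination.hodgeConjectureFor_of_avDominatedBy
    (hodgeConjectureFor_biproduct_comp_of_faces_of_finrank_normalClosure h6 L hL t ht htc hA hΦ hface κ) hB

include hL in
/-- **MAIN THEOREM (intrinsic form).**  `K` a sextic CM field with normal closure of degree `24` or `48`, `t` a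
half-system of embeddings, `A₄ b ⊨ (K; Φ₄ b)` realisations of the four CM types in normal form (`hΦ`, read through
`frameOf h6 t` by the model type `phi`).  **If every rational `(2,2)`-class of the 12-fold `X₀ × X₁ × X₂ × X₃ = ⨁ A₄`
is algebraic, then the Hodge conjecture holds for `⨁_j A₄ (κ j)` for EVERY slot map `κ : Fin N → Fin 4`** — i.e. for
every product of powers `X₀^a × X₁^b × X₂^c × X₃^d`, in every codimension.
[cite: Pohlmann1968, Thm 1] [cite: GaoUllmo2025, Thm 3.1] [cite: Milne2020HodgeClassesAV, Thm. 1] [cite: Dodson1984, §5.1] -/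
theorem hodgeConjectureFor_biproduct_comp_of_hodgeClasses_two_of_finrank_normalClosure
    (hA : ∀ b, IsCMTypeRealisation (Φ₄ b) (A₄ b) (ι₄ b) (θ₄ b))
    (hΦ : ∀ (b : Fin 4) (s : K →+* ℂ),
      s ∈ (Φ₄ b).1 ↔ ((b, (frameOf h6 t ht htc s).1, (frameOf h6 t ht htc s).2) : Pt) ∈ phi)
    (h2 : ∀ c : complexBetti (⨁ A₄).X (2 * 2), IsRationalClass c →
      IsOfHodgeType (⨁ A₄).dim (⨁ A₄).X (2 * 2) 2 2 c → c ∈ algebraicClasses (⨁ A₄).X 2)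
    (κ : Fin N → Fin 4) :
    HodgeConjectureFor (⨁ fun j => A₄ (κ j)).dim (⨁ fun j => A₄ (κ j)).X :=
  hodgeConjectureFor_biproduct_comp_of_hodgeClasses_two κ hA (frameOf_conj h6 t ht htc)
    (realised_rotate_flipAt h6 L hL t ht htc) hΦ h2

include hL in
/-- **… and for every abelian variety dominated by such a power** (isogenous to a product of powers of `X₀, …, X₃`,
their abelian subvarieties and quotients). [cite: Milne2020HodgeClassesAV, Thm. 1] [cite: MumfordAV1970, §19] -/
theorem hodgeConjectureFor_of_avDominatedBy_comp_of_hodgeClasses_two_of_finrank_normalClosure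
    (hA : ∀ b, IsCMTypeRealisation (Φ₄ b) (A₄ b) (ι₄ b) (θ₄ b))
    (hΦ : ∀ (b : Fin 4) (s : K →+* ℂ),
      s ∈ (Φ₄ b).1 ↔ ((b, (frameOf h6 t ht htc s).1, (frameOf h6 t ht htc s).2) : Pt) ∈ phi)
    (h2 : ∀ c : complexBetti (⨁ A₄).X (2 * 2), IsRationalClass c →
      IsOfHodgeType (⨁ A₄).dim (⨁ A₄).X (2 * 2) 2 2 c → c ∈ algebraicClasses (⨁ A₄).X 2)
    (κ : Fin N → Fin 4) {B : AbelianVariety ℂ} (hB : Domination.AVDominatedBy B (⨁ fun j => A₄ (κ j))) :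
    HodgeConjectureFor B.dim B.X :=
  Domination.hodgeConjectureFor_of_avDominatedBy
    (hodgeConjectureFor_biproduct_comp_of_hodgeClasses_two_of_finrank_normalClosure h6 L hL t ht htc hA hΦ h2 κ) hB

include hL in
/-- **The 12-fold itself: HC for `X₀ × X₁ × X₂ × X₃` ⟺ HC in codimension 2 for it** (`κ = id` and the converse
`hodgeClasses_two_of_hodgeConjectureFor_biproduct`). [cite: Pohlmann1968, Thm 1] [cite: GaoUllmo2025, Thm 3.1] -/
theorem hodgeConjectureFor_biproduct_iff_hodgeClasses_two_of_finrank_normalClosure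
    (hA : ∀ b, IsCMTypeRealisation (Φ₄ b) (A₄ b) (ι₄ b) (θ₄ b))
    (hΦ : ∀ (b : Fin 4) (s : K →+* ℂ),
      s ∈ (Φ₄ b).1 ↔ ((b, (frameOf h6 t ht htc s).1, (frameOf h6 t ht htc s).2) : Pt) ∈ phi) :
    HodgeConjectureFor (⨁ A₄).dim (⨁ A₄).X ↔
      ∀ c : complexBetti (⨁ A₄).X (2 * 2), IsRationalClass c →
        IsOfHodgeType (⨁ A₄).dim (⨁ A₄).X (2 * 2) 2 2 c → c ∈ algebraicClasses (⨁ A₄).X 2 :=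
  ⟨hodgeClasses_two_of_hodgeConjectureFor_biproduct, fun h2 =>
    hodgeConjectureFor_biproduct_comp_of_hodgeClasses_two_of_finrank_normalClosure h6 L hL t ht htc hA hΦ h2 id⟩

include hL in
/-- **All powers from the 12-fold**: HC for `X₀ × X₁ × X₂ × X₃` implies HC for every product of powers
`⨁_j A₄ (κ j)` and everything it dominates (codimension 2 of the 12-fold is the only input used).
[cite: Milne2020HodgeClassesAV, Thm. 1] [cite: MumfordAV1970, §19] -/
theorem hodgeConjectureFor_of_avDominatedBy_comp_of_hodgeConjectureFor_biproduct
    (hA : ∀ b, IsCMTypeRealisation (Φ₄ b) (A₄ b) (ι₄ b) (θ₄ b))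
    (hΦ : ∀ (b : Fin 4) (s : K →+* ℂ),
      s ∈ (Φ₄ b).1 ↔ ((b, (frameOf h6 t ht htc s).1, (frameOf h6 t ht htc s).2) : Pt) ∈ phi)
    (hQ : HodgeConjectureFor (⨁ A₄).dim (⨁ A₄).X) (κ : Fin N → Fin 4) {B : AbelianVariety ℂ}
    (hB : Domination.AVDominatedBy B (⨁ fun j => A₄ (κ j))) : HodgeConjectureFor B.dim B.X :=
  hodgeConjectureFor_of_avDominatedBy_comp_of_hodgeClasses_two_of_finrank_normalClosure h6 L hL t ht htc hA hΦ
    (hodgeClasses_two_of_hodgeConjectureFor_biproduct hQ) κ hB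

end Summit.HodgeConjecture.CorCM.PairFlipSexticFourCore

end
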